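import Literature.Analysis.FluidPDE.Wei2016HardyLemma
import Mathlib.MeasureTheory.Integral.IntegralEqImproper
import Mathlib.MeasureTheory.Integral.Prod
import HarnessLib

/-!
# Wei 2016, Lemma 2.2: `a(t)² ≤ ‖J(t)‖_{L²} ‖(u_θ/r)(t)‖_{L²}` in the meridian half-plane

Analysis/FluidPDE proof file (theorems only) on the way to
`Literature.Analysis.FluidPDE.Wei2016_logModulus_regularity`
(`LeiZhang2017AxisymmetricCriteria.lean`), after

* D. Wei, *Regularity criterion to the axially symmetric Navier–Stokes equations*, J. Math. Anal.
  Appl. 435 (2016) 402–413 = arXiv:1508.03318, §2, Lemma 2.2 and its proof: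

> Denote `v(r, z, t) = ∫₀ʳ |u_θ(r', z, t)| dr'` for `r > 0`, `a(t) = ‖(v/r)(t)‖_{L^∞}`, then
> **Lemma 2.2.** `a(t)² ≤ ‖J(t)‖_{L²} ‖(u_θ/r)(t)‖_{L²}`.
> *Proof.* `|v(r', z', t)|² ≤ ∫₀^{r'} r dr ∫₀^{r'} |u_θ(r, z', t)|²/r dr
> = (r'²/2) ∫₀^{r'} dr ∫_z^{+∞} −∂_z (|u_θ|²/r) dz = (r'²/2) ∫₀^{r'} dr ∫ 2 J u_θ dz
> ≤ r'² ∫ |J| |u_θ/r| r dr dz ≤ r'² ‖J(t)‖_{L²} ‖(u_θ/r)(t)‖_{L²}`.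

(Here `J = −∂_z u_θ / r`, and `‖f‖²_{L²} = ∫ |f|² r dr dz` for axially symmetric `|f|²`, §2.)
The lemma is proved in the meridian half-plane `{ρ > 0} × ℝ` for the profiles `H` of `u_θ/r`
and `Hz = ∂_z H` of `−J` (so `|u_θ| = ρ|H|`, `|u_θ|²/r = ρ H²`, `J u_θ = −ρ H Hz`):

* `Wei2016.sq_integral_mul_abs_le` — the Hölder step in `ρ`:
  `(∫₀^{r'} ρ|H| dρ)² ≤ (r'²/2) ∫₀^{r'} ρ H² dρ`;
* `Wei2016.sq_le_two_mul_integral_abs_mul` — the step in `z` along a line: `g(z')² ≤ 2 ∫ |g g'|`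
  for `g`, `g'` square integrable (`g² → 0` at `+∞`);
* `Wei2016.sq_integral_le_mul_sqrt` — **Lemma 2.2**: `v(r', z')² ≤ r'² √(X Y)` with
  `X = ∫∫_{ρ>0} ρ Hz² = ‖J‖²`, `Y = ∫∫_{ρ>0} ρ H² = ‖u_θ/r‖²`, for every `r' > 0`, `z'` (hence
  `a² ≤ ‖J‖ ‖u_θ/r‖`); Tonelli supplies the line integrability for a.e. `ρ`, Cauchy–Schwarz on
  the half-plane is run as `2ρ|H||Hz| ≤ λρHz² + ρH²/λ` optimised in `λ`
  (`Wei2016.sq_le_mul_of_forall_two_mul_le` of `Wei2016HardyLemma.lean`).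

Hypotheses are those the three-dimensional layer supplies for a smooth axisymmetric field with
`u_θ/r ∈ H¹`: `H`, `Hz` continuous on `ℝ²`, `∂_z H = Hz` for `ρ > 0`, `X, Y < ∞`.

## Mathlib search

Used: `MeasureTheory.integral_Ioi_of_hasDerivAt_of_tendsto`,
`MeasureTheory.tendsto_zero_of_hasDerivAt_of_integrableOn_Ioi` (the FTC on `[z', ∞)`),
`MeasureTheory.Integrable.prod_right_ae`, `MeasureTheory.integral_prod`,
`MeasureTheory.Measure.prod_restrict` (Tonelli/Fubini on `(0, ∞) × ℝ`),
`MeasureTheory.setIntegral_mono_ae_restrict`, `MeasureTheory.setIntegral_mono_set`, `integral_id`.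

## References

* D. Wei, J. Math. Anal. Appl. 435 (2016) 402–413, arXiv:1508.03318, Lemma 2.2 and its proof.
  [Wei2016]
-/

noncomputable section

open MeasureTheory Set Filter Topology intervalIntegral Function

namespace Literature.Analysis.FluidPDE

namespace Wei2016

/-! ### Step 1: Cauchy–Schwarz in `r` -/

/-- **The first step of the proof of Lemma 2.2** ("by Hölder inequality we have
`|v(r', z', t)|² ≤ ∫₀^{r'} r dr ∫₀^{r'} |u_θ|²/r dr`"), written for the profile `h = u_θ/r` along
the ray (`|u_θ| = r|h|`, `|u_θ|²/r = r h²`): for continuous `h` and `r' ≥ 0`,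
`(∫₀^{r'} ρ|h(ρ)| dρ)² ≤ (r'²/2) ∫₀^{r'} ρ h(ρ)² dρ` (as `2ρ|h| ≤ λρ + ρh²/λ`, optimised in `λ`).
[cite: Wei2016, proof of Lemma 2.2 (first display)] -/
theorem sq_integral_mul_abs_le {h : ℝ → ℝ} {r' : ℝ} (hr' : 0 ≤ r') (hh : Continuous h) :
    (∫ ρ in (0 : ℝ)..r', ρ * |h ρ|) ^ 2 ≤ r' ^ 2 / 2 * ∫ ρ in (0 : ℝ)..r', ρ * h ρ ^ 2 := by
  set I : ℝ := ∫ ρ in (0 : ℝ)..r', ρ * |h ρ| with hIdef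
  set Q : ℝ := ∫ ρ in (0 : ℝ)..r', ρ * h ρ ^ 2 with hQdef
  have hI0 : 0 ≤ I := intervalIntegral.integral_nonneg hr' fun ρ hρ => mul_nonneg hρ.1 (abs_nonneg _)
  have hQ0 : 0 ≤ Q := intervalIntegral.integral_nonneg hr' fun ρ hρ => mul_nonneg hρ.1 (sq_nonneg _)
  have hA : ∫ ρ in (0 : ℝ)..r', ρ = r' ^ 2 / 2 := by
    rw [integral_id]
    ring
  have hi1 : IntervalIntegrable (fun ρ : ℝ => ρ) volume 0 r' := continuous_id.intervalIntegrable _ _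
  have hi2 : IntervalIntegrable (fun ρ : ℝ => ρ * h ρ ^ 2) volume 0 r' :=
    (continuous_id.mul (hh.pow 2)).intervalIntegrable _ _
  have hkey : ∀ l : ℝ, 0 < l → 2 * I ≤ l * (r' ^ 2 / 2) + Q / l := by
    intro l hl
    have h1 : ∫ ρ in (0 : ℝ)..r', 2 * (ρ * |h ρ|) ≤
        ∫ ρ in (0 : ℝ)..r', (l * ρ + ρ * h ρ ^ 2 / l) := by
      refine integral_mono_on hr' (((continuous_id.mul hh.abs).const_mul 2).intervalIntegrable _ _)
        ((hi1.const_mul l).add (hi2.div_const l)) fun ρ hρ => ?_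
      have h2 := two_mul_abs_le (x := h ρ) (y := l⁻¹) (inv_pos.2 hl)
      rw [one_div, inv_inv] at h2
      have h3 := mul_le_mul_of_nonneg_left h2 hρ.1
      calc 2 * (ρ * |h ρ|) = ρ * (2 * |h ρ|) := by ring
        _ ≤ ρ * (l⁻¹ * h ρ ^ 2 + l) := h3
        _ = l * ρ + ρ * h ρ ^ 2 / l := by ring
    rw [intervalIntegral.integral_const_mul, intervalIntegral.integral_add (hi1.const_mul l)
      (hi2.div_const l), intervalIntegral.integral_const_mul, intervalIntegral.integral_div, hA] at h1
    exact h1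
  exact sq_le_mul_of_forall_two_mul_le hI0 (by positivity) hQ0 hkey

/-! ### Step 2: the fundamental theorem of calculus in `z` -/

/-- **The second step of the proof of Lemma 2.2** ("`|u_θ(r, z')|²/r = ∫_{z'}^{+∞} −∂_z(|u_θ|²/r) dz
= ∫_{z'}^{+∞} 2 J u_θ dz ≤ …`"), along a line: if `g` is differentiable with `g²` and `(g')²`
integrable on `ℝ`, then `g(z')² ≤ 2 ∫ |g g'|` for every `z'` (`g² → 0` at `+∞` because `g²` and
`(g²)' = 2 g g'` are integrable). [cite: Wei2016, proof of Lemma 2.2 (second display)] -/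
theorem sq_le_two_mul_integral_abs_mul {g g' : ℝ → ℝ} (hg : ∀ z, HasDerivAt g (g' z) z)
    (hgi : Integrable (fun z => g z ^ 2)) (hg'i : Integrable (fun z => g' z ^ 2)) (z' : ℝ) :
    g z' ^ 2 ≤ 2 * ∫ z, |g z * g' z| := by
  have hgc : Continuous g := continuous_iff_continuousAt.2 fun z => (hg z).continuousAt
  have hg'm : AEStronglyMeasurable g' volume := by
    have e : g' = deriv g := funext fun z => ((hg z).deriv).symm
    rw [e]
    exact (measurable_deriv g).aestronglyMeasurable
  -- `g g'` is integrable: `|g g'| ≤ (g² + g'²)/2`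
  have hprod : Integrable (fun z => g z * g' z) := by
    refine ((hgi.add hg'i).div_const 2).mono' (hgc.aestronglyMeasurable.mul hg'm)
      (Eventually.of_forall fun z => ?_)
    rw [Real.norm_eq_abs, abs_mul]
    simp only [Pi.add_apply]
    nlinarith [sq_nonneg (|g z| - |g' z|), sq_abs (g z), sq_abs (g' z)]
  have hd : ∀ z, HasDerivAt (fun z => g z ^ 2) (2 * (g z * g' z)) z := fun z => by
    refine ((hg z).fun_pow 2).congr_deriv ?_
    rw [show (2 : ℕ) - 1 = 1 from rfl, pow_one, Nat.cast_ofNat]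
    ring
  have hlim : Tendsto (fun z => g z ^ 2) atTop (𝓝 0) :=
    tendsto_zero_of_hasDerivAt_of_integrableOn_Ioi (a := z') (fun z _ => hd z)
      ((hprod.const_mul 2).integrableOn) hgi.integrableOn
  have hftc : ∫ z in Ioi z', 2 * (g z * g' z) = 0 - g z' ^ 2 :=
    integral_Ioi_of_hasDerivAt_of_tendsto ((hgc.pow 2).continuousWithinAt) (fun z _ => hd z)
      ((hprod.const_mul 2).integrableOn) hlim
  have h1 : g z' ^ 2 = -∫ z in Ioi z', 2 * (g z * g' z) := by
    rw [hftc]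
    ring
  have h2 : |∫ z in Ioi z', 2 * (g z * g' z)| ≤ ∫ z in Ioi z', |2 * (g z * g' z)| := by
    have h := norm_integral_le_integral_norm (μ := volume.restrict (Ioi z'))
      (fun z => 2 * (g z * g' z))
    simpa only [Real.norm_eq_abs] using h
  have h3 : ∫ z in Ioi z', |2 * (g z * g' z)| ≤ ∫ z, |2 * (g z * g' z)| :=
    setIntegral_le_integral ((hprod.const_mul 2).abs) (Eventually.of_forall fun z => abs_nonneg _)
  have h4 : ∫ z, |2 * (g z * g' z)| = 2 * ∫ z, |g z * g' z| := by
    rw [← MeasureTheory.integral_const_mul]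
    refine integral_congr_ae (Eventually.of_forall fun z => ?_)
    show |2 * (g z * g' z)| = 2 * |g z * g' z|
    rw [abs_mul, abs_two]
  calc g z' ^ 2 = -∫ z in Ioi z', 2 * (g z * g' z) := h1
    _ ≤ |∫ z in Ioi z', 2 * (g z * g' z)| := neg_le_abs _
    _ ≤ ∫ z, |2 * (g z * g' z)| := h2.trans h3
    _ = 2 * ∫ z, |g z * g' z| := h4

/-! ### Lemma 2.2 in the meridian half-plane -/

/-- **Wei 2016, Lemma 2.2 (`a(t)² ≤ ‖J(t)‖_{L²} ‖(u_θ/r)(t)‖_{L²}`), in the meridian half-plane.**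
Let `H(ρ, z)` be the profile of `u_θ/r` and `Hz = ∂_z H` that of `−J = ∂_z u_θ/r`
(`u_θ = ρH`), both continuous on `ℝ²`, with `∂_z H = Hz` for `ρ > 0` and the two weighted
Dirichlet-type integrals `X = ∫∫_{ρ>0} ρ Hz²`, `Y = ∫∫_{ρ>0} ρ H²` finite (these are
`‖J‖²_{L²}` and `‖u_θ/r‖²_{L²}` in the measure `r dr dz` of the paper). Then for every `r' > 0` and
`z'`, `v(r', z')² = (∫₀^{r'} ρ|H(ρ, z')| dρ)² ≤ r'² √(XY)`, i.e. `(v/r')² ≤ ‖J‖ ‖u_θ/r‖`, so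
`a(t)² = sup (v/r)² ≤ ‖J‖ ‖u_θ/r‖`. Proof as printed: Hölder in `ρ` (`sq_integral_mul_abs_le`);
for a.e. `ρ > 0` the line functions `z ↦ H(ρ, z)`, `Hz(ρ, z)` are square integrable (Tonelli), so
`ρ H(ρ, z')² ≤ 2ρ ∫ |H Hz|(ρ, z) dz` (`sq_le_two_mul_integral_abs_mul`); integrating in
`ρ ∈ (0, r')` and extending to the half-plane, `∫₀^{r'} ρ H² dρ ≤ 2 ∫∫ ρ|H||Hz| ≤ 2 √X √Y`
(Cauchy–Schwarz). [cite: Wei2016, Lemma 2.2 and its proof] -/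
theorem sq_integral_le_mul_sqrt {H Hz : ℝ → ℝ → ℝ} (hHc : Continuous (uncurry H))
    (hHzc : Continuous (uncurry Hz)) (hderiv : ∀ ρ, 0 < ρ → ∀ z, HasDerivAt (H ρ) (Hz ρ z) z)
    (hX : IntegrableOn (fun p : ℝ × ℝ => p.1 * Hz p.1 p.2 ^ 2) (Ioi 0 ×ˢ univ))
    (hY : IntegrableOn (fun p : ℝ × ℝ => p.1 * H p.1 p.2 ^ 2) (Ioi 0 ×ˢ univ)) {r' : ℝ}
    (hr' : 0 < r') (z' : ℝ) :
    (∫ ρ in (0 : ℝ)..r', ρ * |H ρ z'|) ^ 2 ≤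
      r' ^ 2 * Real.sqrt ((∫ p in Ioi (0 : ℝ) ×ˢ (univ : Set ℝ), p.1 * Hz p.1 p.2 ^ 2) *
        ∫ p in Ioi (0 : ℝ) ×ˢ (univ : Set ℝ), p.1 * H p.1 p.2 ^ 2) := by
  -- the restricted product measure
  set S : Set (ℝ × ℝ) := Ioi (0 : ℝ) ×ˢ (univ : Set ℝ) with hS
  have hSm : MeasurableSet S := measurableSet_Ioi.prod MeasurableSet.univ
  set σ : Measure (ℝ × ℝ) := volume.restrict S with hσ
  have hσprod : σ = (volume.restrict (Ioi (0 : ℝ))).prod (volume : Measure ℝ) := by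
    rw [hσ, hS, Measure.volume_eq_prod, ← Measure.prod_restrict, Measure.restrict_univ]
  set X : ℝ := ∫ p in S, p.1 * Hz p.1 p.2 ^ 2 with hXdef
  set Y : ℝ := ∫ p in S, p.1 * H p.1 p.2 ^ 2 with hYdef
  have hmemS : ∀ᵐ p ∂σ, p ∈ S := ae_restrict_mem hSm
  have hX0 : 0 ≤ X := by
    refine setIntegral_nonneg hSm fun p hp => ?_
    exact mul_nonneg (le_of_lt hp.1) (sq_nonneg _)
  have hY0 : 0 ≤ Y := by
    refine setIntegral_nonneg hSm fun p hp => ?_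
    exact mul_nonneg (le_of_lt hp.1) (sq_nonneg _)
  -- continuity of the sections and of the integrands
  have hHρ : ∀ ρ, Continuous (H ρ) := fun ρ => hHc.comp (Continuous.prodMk_right ρ)
  have hHzρ : ∀ ρ, Continuous (Hz ρ) := fun ρ => hHzc.comp (Continuous.prodMk_right ρ)
  have hHz' : ∀ z, Continuous fun ρ => H ρ z := fun z => hHc.comp (Continuous.prodMk_left z)
  have hcX : Continuous fun p : ℝ × ℝ => p.1 * Hz p.1 p.2 ^ 2 := continuous_fst.mul (hHzc.pow 2)
  have hcY : Continuous fun p : ℝ × ℝ => p.1 * H p.1 p.2 ^ 2 := continuous_fst.mul (hHc.pow 2)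
  have hcP : Continuous fun p : ℝ × ℝ => p.1 * |H p.1 p.2 * Hz p.1 p.2| :=
    continuous_fst.mul (hHc.mul hHzc).abs
  -- the mixed integrand `ρ |H Hz| ≤ (ρ Hz² + ρ H²)/2` is integrable on the half-plane
  have hP : IntegrableOn (fun p : ℝ × ℝ => p.1 * |H p.1 p.2 * Hz p.1 p.2|) S := by
    refine ((hX.add hY).div_const 2).mono' hcP.aestronglyMeasurable ?_
    filter_upwards [hmemS] with p hp
    have hρ : 0 ≤ p.1 := le_of_lt hp.1
    rw [Real.norm_eq_abs, abs_mul, abs_of_nonneg hρ, abs_abs, abs_mul]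
    have : 2 * (|H p.1 p.2| * |Hz p.1 p.2|) ≤ Hz p.1 p.2 ^ 2 + H p.1 p.2 ^ 2 := by
      nlinarith [sq_nonneg (|H p.1 p.2| - |Hz p.1 p.2|), sq_abs (H p.1 p.2), sq_abs (Hz p.1 p.2)]
    have := mul_le_mul_of_nonneg_left this hρ
    simp only [Pi.add_apply]
    nlinarith
  set T : ℝ := ∫ p in S, p.1 * |H p.1 p.2 * Hz p.1 p.2| with hTdef
  have hT0 : 0 ≤ T := setIntegral_nonneg hSm fun p hp => mul_nonneg (le_of_lt hp.1) (abs_nonneg _)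
  -- Cauchy–Schwarz on the half-plane: `T ≤ √(XY)`
  have hTle : T ≤ Real.sqrt (X * Y) := by
    have hkey : ∀ l : ℝ, 0 < l → 2 * T ≤ l * X + Y / l := by
      intro l hl
      have h1 : ∫ p in S, 2 * (p.1 * |H p.1 p.2 * Hz p.1 p.2|) ≤
          ∫ p in S, (l * (p.1 * Hz p.1 p.2 ^ 2) + p.1 * H p.1 p.2 ^ 2 / l) := by
        refine setIntegral_mono_ae_restrict (hP.const_mul 2) ((hX.const_mul l).add (hY.div_const l)) ?_
        filter_upwards [hmemS] with p hp
        have hρ : 0 ≤ p.1 := le_of_lt hp.1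
        have h2 : 2 * |H p.1 p.2 * Hz p.1 p.2| ≤ l * Hz p.1 p.2 ^ 2 + H p.1 p.2 ^ 2 / l := by
          -- `2|H||Hz| ≤ λ Hz² + H²/λ` from `(λ|Hz| − |H|)²/λ ≥ 0`
          rw [abs_mul]
          set a := |H p.1 p.2|
          set b := |Hz p.1 p.2|
          have key : l * Hz p.1 p.2 ^ 2 + H p.1 p.2 ^ 2 / l - 2 * (a * b) = (l * b - a) ^ 2 / l := by
            rw [← sq_abs (Hz p.1 p.2), ← sq_abs (H p.1 p.2)]
            field_simp
            ring
          have hnn : 0 ≤ (l * b - a) ^ 2 / l := div_nonneg (sq_nonneg _) hl.le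
          linarith
        have := mul_le_mul_of_nonneg_left h2 hρ
        calc 2 * (p.1 * |H p.1 p.2 * Hz p.1 p.2|) = p.1 * (2 * |H p.1 p.2 * Hz p.1 p.2|) := by ring
          _ ≤ p.1 * (l * Hz p.1 p.2 ^ 2 + H p.1 p.2 ^ 2 / l) := this
          _ = l * (p.1 * Hz p.1 p.2 ^ 2) + p.1 * H p.1 p.2 ^ 2 / l := by ring
      rw [MeasureTheory.integral_const_mul, integral_add (hX.const_mul l) (hY.div_const l),
        MeasureTheory.integral_const_mul, MeasureTheory.integral_div] at h1
      exact h1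
    have hsq : T ^ 2 ≤ X * Y := sq_le_mul_of_forall_two_mul_le hT0 hX0 hY0 hkey
    calc T = Real.sqrt (T ^ 2) := (Real.sqrt_sq hT0).symm
      _ ≤ Real.sqrt (X * Y) := Real.sqrt_le_sqrt hsq
  -- Tonelli: for a.e. `ρ > 0` the line functions are square integrable
  have hXσ : Integrable (fun p : ℝ × ℝ => p.1 * Hz p.1 p.2 ^ 2)
      ((volume.restrict (Ioi (0 : ℝ))).prod (volume : Measure ℝ)) := by
    rw [← hσprod]; exact hX
  have hYσ : Integrable (fun p : ℝ × ℝ => p.1 * H p.1 p.2 ^ 2)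
      ((volume.restrict (Ioi (0 : ℝ))).prod (volume : Measure ℝ)) := by
    rw [← hσprod]; exact hY
  have hPσ : Integrable (fun p : ℝ × ℝ => p.1 * |H p.1 p.2 * Hz p.1 p.2|)
      ((volume.restrict (Ioi (0 : ℝ))).prod (volume : Measure ℝ)) := by
    rw [← hσprod]; exact hP
  have hae : ∀ᵐ ρ ∂(volume.restrict (Ioi (0 : ℝ))),
      0 < ρ ∧ Integrable (fun z => Hz ρ z ^ 2) ∧ Integrable (fun z => H ρ z ^ 2) := by
    filter_upwards [ae_restrict_mem measurableSet_Ioi, hXσ.prod_right_ae, hYσ.prod_right_ae]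
      with ρ hρ h1 h2
    have hρ0 : (0 : ℝ) < ρ := hρ
    refine ⟨hρ0, ?_, ?_⟩
    · have h := h1.const_mul ρ⁻¹
      refine h.congr (Eventually.of_forall fun z => ?_)
      simp only
      field_simp
    · have h := h2.const_mul ρ⁻¹
      refine h.congr (Eventually.of_forall fun z => ?_)
      simp only
      field_simp
  -- the bound `ρ H(ρ, z')² ≤ Φ ρ = 2 ρ ∫ |H Hz|(ρ, ·)` for a.e. `ρ > 0`
  set Φ : ℝ → ℝ := fun ρ => ∫ z, 2 * (ρ * |H ρ z * Hz ρ z|) with hΦdef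
  have hbound : ∀ᵐ ρ ∂(volume.restrict (Ioi (0 : ℝ))), ρ * H ρ z' ^ 2 ≤ Φ ρ := by
    filter_upwards [hae] with ρ hρ
    obtain ⟨hρ0, hi1, hi2⟩ := hρ
    have h := sq_le_two_mul_integral_abs_mul (hderiv ρ hρ0) hi2 hi1 z'
    have e : Φ ρ = ρ * (2 * ∫ z, |H ρ z * Hz ρ z|) := by
      simp only [hΦdef]
      rw [← MeasureTheory.integral_const_mul, ← MeasureTheory.integral_const_mul]
      refine integral_congr_ae (Eventually.of_forall fun z => ?_)
      show 2 * (ρ * |H ρ z * Hz ρ z|) = ρ * (2 * |H ρ z * Hz ρ z|)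
      ring
    rw [e]
    exact mul_le_mul_of_nonneg_left h hρ0.le
  -- `Φ` is integrable on `(0, ∞)` with integral `2T` (Fubini)
  have hP2σ : Integrable (fun p : ℝ × ℝ => 2 * (p.1 * |H p.1 p.2 * Hz p.1 p.2|))
      ((volume.restrict (Ioi (0 : ℝ))).prod (volume : Measure ℝ)) := hPσ.const_mul 2
  have hΦint : Integrable Φ (volume.restrict (Ioi (0 : ℝ))) := hP2σ.integral_prod_left
  have hΦon : IntegrableOn Φ (Ioi (0 : ℝ)) := hΦint
  have hΦeq : ∫ ρ in Ioi (0 : ℝ), Φ ρ = 2 * T := by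
    have h := (integral_prod _ hP2σ).symm
    rw [← hσprod] at h
    simp only [hΦdef]
    rw [h, MeasureTheory.integral_const_mul]
  have hΦ0 : 0 ≤ᵐ[volume.restrict (Ioi (0 : ℝ))] Φ := by
    filter_upwards [ae_restrict_mem measurableSet_Ioi] with ρ hρ
    refine integral_nonneg fun z => ?_
    have : (0 : ℝ) < ρ := hρ
    positivity
  -- `Q = ∫₀^{r'} ρ H(ρ, z')² dρ ≤ ∫_{(0, r')} Φ ≤ ∫_{(0, ∞)} Φ = 2T`
  have hQ : ∫ ρ in (0 : ℝ)..r', ρ * H ρ z' ^ 2 ≤ 2 * T := by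
    rw [intervalIntegral.integral_of_le hr'.le]
    have hsub : Ioc (0 : ℝ) r' ⊆ Ioi 0 := fun ρ hρ => hρ.1
    have h1 : ∫ ρ in Ioc (0 : ℝ) r', ρ * H ρ z' ^ 2 ≤ ∫ ρ in Ioc (0 : ℝ) r', Φ ρ := by
      refine setIntegral_mono_ae_restrict ?_ (hΦon.mono_set hsub) ?_
      · exact ((continuous_id.mul ((hHz' z').pow 2)).integrableOn_Icc).mono_set Ioc_subset_Icc_self
      · exact ae_restrict_of_ae_restrict_of_subset hsub hbound
    have h2 : ∫ ρ in Ioc (0 : ℝ) r', Φ ρ ≤ ∫ ρ in Ioi (0 : ℝ), Φ ρ :=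
      setIntegral_mono_set hΦon hΦ0 (Eventually.of_forall hsub)
    linarith [hΦeq]
  -- assemble
  have hCS := sq_integral_mul_abs_le hr'.le (hHz' z')
  calc (∫ ρ in (0 : ℝ)..r', ρ * |H ρ z'|) ^ 2 ≤ r' ^ 2 / 2 * ∫ ρ in (0 : ℝ)..r', ρ * H ρ z' ^ 2 := hCS
    _ ≤ r' ^ 2 / 2 * (2 * T) := mul_le_mul_of_nonneg_left hQ (by positivity)
    _ = r' ^ 2 * T := by ring
    _ ≤ r' ^ 2 * Real.sqrt (X * Y) := mul_le_mul_of_nonneg_left hTle (sq_nonneg _)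


end Wei2016

end Literature.Analysis.FluidPDE

end
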